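import Literature.AlgebraicGeometry.Motives.ProjectiveBundlePoleOrders
import HarnessLib

/-!
# Polynomial point counts are inherited by `X × ℙⁿ`:
# `#X(𝔽_{q^m}) = Σ_{r≤N} c_r q^{rm}` ⟹ `#(X × ℙⁿ)(𝔽_{q^m}) = Σ_{s≤N+n} (Σ_{i≤n, i≤s, s−i≤N} c_{s−i}) q^{sm}`;
# hence `H^{2r}(X × ℙⁿ)(r)` is generalized-unipotent under every `φ_r(Fᵐ)`, the pole orders of
# `Z((X × ℙⁿ) ⊗ 𝔽_{q^m})` are the Betti numbers, and the even Betti numbers of `X × ℙⁿ` follow from POLE ORDERS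

Topic `Literature/AlgebraicGeometry/Motives`; THEOREMS ONLY (no definition, no instance, no named fact; D-0026).
Makes the engine of g52-#7 (`maxGenEigenspace_ρTwist_pow_eq_top_of_pointCount_eq_sum`,
`hasPoleOfOrderAt_zetaSeriesPow_of_pointCount_eq_sum`) run on projective bundles `X × ℙⁿ` and cross-checks it
against g52-#11's count `ord_{(q^m)^{−r}} Z_m(X × ℙⁿ) = Σᵢ dim H^{2(r−i)}(X)(r−i)_{(φ^m),1}`.

* §1 (pure algebra): **`sum_range_mul_geom_sum_eq`** (`(Σ_{r≤N} c_r xʳ)(Σ_{i≤n} xⁱ) = Σ_{s≤N+n} c'_s xˢ`,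
  `c'_s = Σ_{i≤n, i≤s, s−i≤N} c_{s−i}` — the Cauchy product with `1 + x + ⋯ + xⁿ`).
* §2 (E-free): **`pointCount_tensor_projectiveSpace_cast_eq_sum`** (the polynomial-count normal form of
  `Motives/PolynomialPointCountsBettiNumbers` for `X × ℙⁿ` from that of `X`).
* §3 (`E` with the trace formula, `χ(φ) = q`, RH for `X × ℙⁿ`):
  **`GaloisWeilCohomology.maxGenEigenspace_ρTwist_pow_tensor_projectiveSpace_eq_top_of_pointCount_eq_sum`**
  (`H^{2r}(X × ℙⁿ)(r) = H^{2r}(X × ℙⁿ)(r)_{(φ_r(Fᵐ)),1}`, every `r`, `m`),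
  **`hasPoleOfOrderAt_zetaSeriesPow_tensor_projectiveSpace_finrank_of_pointCount_eq_sum`**
  (`ord_{(q^m)^{−r}} Z_m(X × ℙⁿ) = b_{2r}(X × ℙⁿ)`, `r ≤ d + n`, every `m ≥ 1`),
  **`finrank_tensor_projectiveSpace_two_mul_of_pointCount_eq_sum`** (`b_{2r}(X × ℙⁿ) = Σ_{i≤n, i≤r, r−i≤d} b_{2(r−i)}(X)`
  for `r ≤ d + n` — the projective bundle formula for the even Betti numbers obtained by comparing two pole-order
  computations, `HasPoleOfOrderAt.unique`), `algebraicClasses_tensor_projectiveSpace_eq_top_of_pointCount_eq_sum`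
  (`S` and `T` for `X × ℙⁿ` ⟹ all of `H^{2r}(X × ℙⁿ)` algebraic).

HC is not touched.

## References

* [Gottsche1993] L. Göttsche, Hilbert Schemes of Zero-Dimensional Subschemes of Smooth Varieties, LNM 1572 (1993),
  §1.2 Remark 1.2.2 (`p(X̄, −z) = F(z², p(S̄, −z))`, `F(t,s) = (1 + t + ⋯ + tⁿ)s` for `X = S × ℙⁿ`).
* [TateWoodsHole1965] J. Tate, Algebraic cycles and poles of zeta functions (1965), §3.
* [Kahn2020] B. Kahn, Zeta and L-Functions of Varieties and Motives (2020), Prop. 2.3 (4), (5); §6.14 Conj. 6.52, Th. 6.53.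
* [Tate1994] J. Tate, Conjectures on algebraic cycles in ℓ-adic cohomology (1994), §2 Th. 2.9.
* [Milne1986ValuesZetaFunctionsFiniteFields] J. S. Milne, Amer. J. Math. 108 (1986), §8 Prop. 8.2.
* [Hartshorne1977] R. Hartshorne, Algebraic Geometry (1977), App. C Ex. 5.2; II Ex. 4.9.
* Tree: `Motives/PolynomialPointCountsBettiNumbers`, `Motives/ZetaFunctionOfProjectiveSpaceOverBase`
  (`pointCount_tensor_projectiveSpace`), `Motives/ProjectiveSpaceFiniteFieldCohomology` (`isSmoothProjective_tensor_projectiveSpace`,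
  `finrank_tensor_projectiveSpace`), `Motives/SplitQuadricConstantFieldExtensions` (g52-#7), `Motives/ProjectiveBundlePoleOrders` (g52-#11).

## Provenance

Lane `lit-hodgefound` (summit `HodgeConjecture`, Track 2 foundations library, Layer B: motives ∕ varieties over finite
fields), seat `lit-hodgefound-p29` (literature-prover, generation 52, row g52-#12).
-/

universe u v

open Polynomial Finset CategoryTheory MonoidalCategory AlgebraicGeometry
open Literature.AlgebraicGeometry.Kahn2003 (HasPoleOfOrderAt)

noncomputable section

namespace Literature.AlgebraicGeometry.Motives

/-! ### §1 The Cauchy product with `1 + x + ⋯ + xⁿ` -/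

/-- **`(Σ_{r≤N} c_r xʳ) · (Σ_{i≤n} xⁱ) = Σ_{s≤N+n} (Σ_{i≤n, i≤s, s−i≤N} c_{s−i}) xˢ`** — the coefficients of the product
with the point count `1 + x + ⋯ + xⁿ` of `ℙⁿ` (`x = q^m`), Göttsche's `F(t, s) = (1 + t + ⋯ + tⁿ)s`.
[cite: Gottsche1993, §1.2 Remark 1.2.2] -/
theorem sum_range_mul_geom_sum_eq (c : ℕ → ℚ) (N n : ℕ) (x : ℚ) :
    (∑ r ∈ Finset.range (N + 1), c r * x ^ r) * (∑ i ∈ Finset.range (n + 1), x ^ i) =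
      ∑ s ∈ Finset.range (N + n + 1),
        (∑ i ∈ Finset.range (n + 1), if i ≤ s ∧ s - i ≤ N then c (s - i) else 0) * x ^ s := by
  -- for fixed `i`, the inner sum over `s` is the sum over `r = s − i ≤ N`
  have key : ∀ i ∈ Finset.range (n + 1),
      ∑ s ∈ Finset.range (N + n + 1), (if i ≤ s ∧ s - i ≤ N then c (s - i) else 0) * x ^ s =
        ∑ r ∈ Finset.range (N + 1), c r * x ^ (r + i) := by
    intro i hi
    rw [Finset.mem_range] at hi
    have himg : ∑ r ∈ Finset.range (N + 1), c r * x ^ (r + i) =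
        ∑ s ∈ (Finset.range (N + 1)).image (fun r => r + i),
          (if i ≤ s ∧ s - i ≤ N then c (s - i) else 0) * x ^ s := by
      rw [Finset.sum_image (fun r _ r' _ h => by simpa using h)]
      refine Finset.sum_congr rfl fun r hr => ?_
      rw [Finset.mem_range] at hr
      rw [if_pos ⟨by omega, by omega⟩, add_tsub_cancel_right]
    rw [himg]
    symm
    refine Finset.sum_subset (fun s hs => ?_) (fun s _ hns => ?_)
    · obtain ⟨r, hr, rfl⟩ := Finset.mem_image.mp hs
      rw [Finset.mem_range] at hr ⊢
      omega
    · rw [if_neg, zero_mul]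
      rintro ⟨h1, h2⟩
      exact hns (Finset.mem_image.mpr ⟨s - i, Finset.mem_range.mpr (by omega), by omega⟩)
  calc (∑ r ∈ Finset.range (N + 1), c r * x ^ r) * (∑ i ∈ Finset.range (n + 1), x ^ i)
      = ∑ r ∈ Finset.range (N + 1), ∑ i ∈ Finset.range (n + 1), c r * x ^ (r + i) := by
        rw [Finset.sum_mul_sum]
        refine Finset.sum_congr rfl fun r _ => Finset.sum_congr rfl fun i _ => ?_
        rw [pow_add, mul_assoc]
    _ = ∑ i ∈ Finset.range (n + 1), ∑ r ∈ Finset.range (N + 1), c r * x ^ (r + i) := Finset.sum_comm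
    _ = ∑ i ∈ Finset.range (n + 1), ∑ s ∈ Finset.range (N + n + 1),
          (if i ≤ s ∧ s - i ≤ N then c (s - i) else 0) * x ^ s :=
        Finset.sum_congr rfl fun i hi => (key i hi).symm
    _ = ∑ s ∈ Finset.range (N + n + 1),
          (∑ i ∈ Finset.range (n + 1), if i ≤ s ∧ s - i ≤ N then c (s - i) else 0) * x ^ s := by
        rw [Finset.sum_comm]
        exact Finset.sum_congr rfl fun s _ => by rw [Finset.sum_mul]

/-! ### §2 `X × ℙⁿ` has polynomial point counts when `X` has -/

section EFree

variable {k : Type u} [Field k] [Finite k] (X : SchemeOver k)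

/-- **`#X(𝔽_{q^m}) = Σ_{r≤N} c_r q^{rm}` for all `m ≥ 1` ⟹ `#(X × ℙⁿ)(𝔽_{q^m}) = Σ_{s≤N+n} c'_s q^{sm}`** with
`c'_s = Σ_{i≤n, i≤s, s−i≤N} c_{s−i}` (`#(X × ℙⁿ) = #X · (1 + q^m + ⋯ + q^{nm})`, the tree's
`pointCount_tensor_projectiveSpace`), in the normal form of `Motives/PolynomialPointCountsBettiNumbers`.
[cite: Gottsche1993, §1.2 Remark 1.2.2] [cite: Hartshorne1977, App. C Ex. 5.2] -/
theorem pointCount_tensor_projectiveSpace_cast_eq_sum {c : ℕ → ℚ} {N : ℕ}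
    (hc : ∀ m : ℕ, 0 < m →
      (pointCount X m : ℚ) = ∑ r ∈ Finset.range (N + 1), c r * (Nat.card k : ℚ) ^ (r * m))
    (n : ℕ) {m : ℕ} (hm : 0 < m) :
    (pointCount (X ⊗ projectiveSpace n k) m : ℚ) =
      ∑ s ∈ Finset.range (N + n + 1),
        (∑ i ∈ Finset.range (n + 1), if i ≤ s ∧ s - i ≤ N then c (s - i) else 0) *
          (Nat.card k : ℚ) ^ (s * m) := by
  have h1 : ∑ r ∈ Finset.range (N + 1), c r * (Nat.card k : ℚ) ^ (r * m) =
      ∑ r ∈ Finset.range (N + 1), c r * ((Nat.card k : ℚ) ^ m) ^ r :=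
    Finset.sum_congr rfl fun r _ => by rw [mul_comm r m, pow_mul]
  have h2 : ((∑ i ∈ Finset.range (n + 1), Nat.card k ^ (m * i) : ℕ) : ℚ) =
      ∑ i ∈ Finset.range (n + 1), ((Nat.card k : ℚ) ^ m) ^ i := by
    rw [Nat.cast_sum]
    exact Finset.sum_congr rfl fun i _ => by rw [Nat.cast_pow, pow_mul]
  have h3 : ∑ s ∈ Finset.range (N + n + 1),
        (∑ i ∈ Finset.range (n + 1), if i ≤ s ∧ s - i ≤ N then c (s - i) else 0) * (Nat.card k : ℚ) ^ (s * m) =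
      ∑ s ∈ Finset.range (N + n + 1),
        (∑ i ∈ Finset.range (n + 1), if i ≤ s ∧ s - i ≤ N then c (s - i) else 0) * ((Nat.card k : ℚ) ^ m) ^ s :=
    Finset.sum_congr rfl fun s _ => by rw [mul_comm s m, pow_mul]
  rw [pointCount_tensor_projectiveSpace X hm, Nat.cast_mul, hc m hm, h1, h2, h3]
  exact sum_range_mul_geom_sum_eq c N n _

end EFree

/-! ### §3 In cohomology: the projective bundle inherits the Tate-type statements -/

namespace GaloisWeilCohomology

variable {k : Type u} [Field k] [Finite k] {K : Type v} [Field K] [CharZero K]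
  {χ : Field.absoluteGaloisGroup k →* Kˣ} (E : GaloisWeilCohomology k K χ)
variable {d : ℕ} {X : SchemeOver k}

/-- **`H^{2r}(X × ℙⁿ)(r) = H^{2r}(X × ℙⁿ)(r)_{(φ_r(Fᵐ)),1}` for every `r` and every `m`** when `X` has polynomial point
counts (g52-#7's engine on the inherited counts of §2). [cite: Gottsche1993, §1.2 Remark 1.2.2] [cite: Tate1994, §2 Th. 2.9] -/
theorem maxGenEigenspace_ρTwist_pow_tensor_projectiveSpace_eq_top_of_pointCount_eq_sum
    (hE : E.HasLefschetzTraceFormula) (hχ : ((χ (arithFrob k) : Kˣ) : K) = Nat.card k)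
    (hX : IsSmoothProjective d X) (n : ℕ)
    (hRH : E.WeilRiemannHypothesisFor (X ⊗ projectiveSpace n k) (d + n)) {c : ℕ → ℚ} {N : ℕ}
    (hc : ∀ m : ℕ, 0 < m →
      (pointCount X m : ℚ) = ∑ r ∈ Finset.range (N + 1), c r * (Nat.card k : ℚ) ^ (r * m))
    (r m : ℕ) :
    Module.End.maxGenEigenspace (E.ρTwist (X ⊗ projectiveSpace n k) (2 * r) r (geomFrob k ^ m)) 1 = ⊤ :=
  E.maxGenEigenspace_ρTwist_pow_eq_top_of_pointCount_eq_sum hE hχ (isSmoothProjective_tensor_projectiveSpace hX n)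
    hRH (c := fun s => ∑ i ∈ Finset.range (n + 1), if i ≤ s ∧ s - i ≤ N then c (s - i) else 0)
    (fun _ hm => pointCount_tensor_projectiveSpace_cast_eq_sum X hc n hm) r m

/-- **`ord_{(q^m)^{−r}} Z((X × ℙⁿ) ⊗ 𝔽_{q^m}) = b_{2r}(X × ℙⁿ)` for every `m ≥ 1`, `r ≤ d + n`** when `X` has
polynomial point counts. [cite: TateWoodsHole1965, §3] [cite: Kahn2020, §6.14 Conj. 6.52] [cite: Gottsche1993, §1.2 Remark 1.2.2] -/
theorem hasPoleOfOrderAt_zetaSeriesPow_tensor_projectiveSpace_finrank_of_pointCount_eq_sum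
    (hE : E.HasLefschetzTraceFormula) (hχ : ((χ (arithFrob k) : Kˣ) : K) = Nat.card k)
    (hX : IsSmoothProjective d X) (n : ℕ)
    (hRH : E.WeilRiemannHypothesisFor (X ⊗ projectiveSpace n k) (d + n)) {c : ℕ → ℚ} {N : ℕ}
    (hc : ∀ m : ℕ, 0 < m →
      (pointCount X m : ℚ) = ∑ r ∈ Finset.range (N + 1), c r * (Nat.card k : ℚ) ^ (r * m))
    {r : ℕ} (hr : r ≤ d + n) {m : ℕ} (hm : 0 < m) :
    HasPoleOfOrderAt (zetaSeriesPow (X ⊗ projectiveSpace n k) m) ((((Nat.card k : ℚ) ^ m) ^ r)⁻¹)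
      (Module.finrank K (E.obj (X ⊗ projectiveSpace n k) (2 * r))) :=
  E.hasPoleOfOrderAt_zetaSeriesPow_of_pointCount_eq_sum hE hχ (isSmoothProjective_tensor_projectiveSpace hX n)
    hRH (c := fun s => ∑ i ∈ Finset.range (n + 1), if i ≤ s ∧ s - i ≤ N then c (s - i) else 0)
    (fun _ hm => pointCount_tensor_projectiveSpace_cast_eq_sum X hc n hm) hr hm

/-- **The even Betti numbers of the projective bundle from pole orders: `b_{2r}(X × ℙⁿ) = Σ_{i≤n, i≤r, r−i≤d} b_{2(r−i)}(X)`**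
(`r ≤ d + n`) for `X` with polynomial point counts — two computations of `ord_{q^{−r}} Z(X × ℙⁿ)` (the inherited
polynomial count above; g52-#11's transfer from `X`) compared by `HasPoleOfOrderAt.unique`.
[cite: Gottsche1993, §1.2 Remark 1.2.2] [cite: TateWoodsHole1965, §3] -/
theorem finrank_tensor_projectiveSpace_two_mul_of_pointCount_eq_sum
    (hE : E.HasLefschetzTraceFormula) (hχ : ((χ (arithFrob k) : Kˣ) : K) = Nat.card k)
    (hX : IsSmoothProjective d X) (hXRH : E.WeilRiemannHypothesisFor X d) (n : ℕ)
    (hRH : E.WeilRiemannHypothesisFor (X ⊗ projectiveSpace n k) (d + n)) {c : ℕ → ℚ} {N : ℕ}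
    (hc : ∀ m : ℕ, 0 < m →
      (pointCount X m : ℚ) = ∑ r ∈ Finset.range (N + 1), c r * (Nat.card k : ℚ) ^ (r * m))
    {r : ℕ} (hr : r ≤ d + n) :
    Module.finrank K (E.obj (X ⊗ projectiveSpace n k) (2 * r)) =
      ∑ i ∈ Finset.range (n + 1), if i ≤ r ∧ r - i ≤ d then Module.finrank K (E.obj X (2 * (r - i))) else 0 :=
  (E.hasPoleOfOrderAt_zetaSeriesPow_tensor_projectiveSpace_finrank_of_pointCount_eq_sum hE hχ hX n hRH hc hr
      one_pos).unique
    (E.hasPoleOfOrderAt_zetaSeriesPow_tensor_projectiveSpace_of_pointCount_eq_sum hE hχ hX hXRH hc n one_pos r)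

/-- **`φ_r` semisimple at `1` on `H^{2r}(X × ℙⁿ)` ⟹ `φ_r(Fᵐ) = 1` there for every `m`** (polynomial counts for `X`).
[cite: Kahn2020, §6.14 Th. 6.53] [cite: Milne1986ValuesZetaFunctionsFiniteFields, §8 Prop. 8.2] -/
theorem ker_ρTwist_pow_sub_one_tensor_projectiveSpace_eq_top_of_pointCount_eq_sum
    (hE : E.HasLefschetzTraceFormula) (hχ : ((χ (arithFrob k) : Kˣ) : K) = Nat.card k)
    (hX : IsSmoothProjective d X) (n : ℕ)
    (hRH : E.WeilRiemannHypothesisFor (X ⊗ projectiveSpace n k) (d + n)) {c : ℕ → ℚ} {N : ℕ}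
    (hc : ∀ m : ℕ, 0 < m →
      (pointCount X m : ℚ) = ∑ r ∈ Finset.range (N + 1), c r * (Nat.card k : ℚ) ^ (r * m))
    (r : ℕ)
    (hS : LinearMap.ker (E.ρTwist (X ⊗ projectiveSpace n k) (2 * r) r (geomFrob k) - 1) ⊓
      LinearMap.range (E.ρTwist (X ⊗ projectiveSpace n k) (2 * r) r (geomFrob k) - 1) = ⊥) (m : ℕ) :
    LinearMap.ker (E.ρTwist (X ⊗ projectiveSpace n k) (2 * r) r (geomFrob k ^ m) - 1) = ⊤ :=
  E.ker_ρTwist_pow_sub_one_eq_top_of_pointCount_eq_sum hE hχ (isSmoothProjective_tensor_projectiveSpace hX n)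
    hRH (c := fun s => ∑ i ∈ Finset.range (n + 1), if i ≤ s ∧ s - i ≤ N then c (s - i) else 0)
    (fun _ hm => pointCount_tensor_projectiveSpace_cast_eq_sum X hc n hm) r hS m

/-- **All of `H^{2r}(X × ℙⁿ)` is algebraic, granted `S` and `T` (Milne's Frobenius form `K·Aʳ = Ker(φ_r − 1)`) for
`X × ℙⁿ` in codimension `r`** (polynomial counts for `X`; the tree's `algebraicClasses_eq_top_of_pointCount_eq_sum`
on the inherited counts). [cite: Tate1994, §2 Th. 2.9] [cite: Milne1986ValuesZetaFunctionsFiniteFields, §8 Prop. 8.2] -/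
theorem algebraicClasses_tensor_projectiveSpace_eq_top_of_pointCount_eq_sum
    (hE : E.HasLefschetzTraceFormula) (hχ : ((χ (arithFrob k) : Kˣ) : K) = Nat.card k)
    (hX : IsSmoothProjective d X) (n : ℕ)
    (hRH : E.WeilRiemannHypothesisFor (X ⊗ projectiveSpace n k) (d + n)) {c : ℕ → ℚ} {N : ℕ}
    (hc : ∀ m : ℕ, 0 < m →
      (pointCount X m : ℚ) = ∑ r ∈ Finset.range (N + 1), c r * (Nat.card k : ℚ) ^ (r * m))
    (r : ℕ)
    (hS : LinearMap.ker (E.ρTwist (X ⊗ projectiveSpace n k) (2 * r) r (geomFrob k) - 1) ⊓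
      LinearMap.range (E.ρTwist (X ⊗ projectiveSpace n k) (2 * r) r (geomFrob k) - 1) = ⊥)
    (hT : E.algebraicClasses (X ⊗ projectiveSpace n k) r =
      LinearMap.ker (E.ρTwist (X ⊗ projectiveSpace n k) (2 * r) r (geomFrob k) - 1)) :
    E.algebraicClasses (X ⊗ projectiveSpace n k) r = ⊤ :=
  E.algebraicClasses_eq_top_of_pointCount_eq_sum hE hχ (isSmoothProjective_tensor_projectiveSpace hX n) hRH
    (c := fun s => ∑ i ∈ Finset.range (n + 1), if i ≤ s ∧ s - i ≤ N then c (s - i) else 0)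
    (fun _ hm => pointCount_tensor_projectiveSpace_cast_eq_sum X hc n hm) r hS hT

end GaloisWeilCohomology

end Literature.AlgebraicGeometry.Motives

end
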